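import Summits.BirchSwinnertonDyer.BirchSwinnertonDyer.Theorems.SmallImageMuTransferMuTransferX9KolyvaginClassTwistLocal
import Literature.NumberTheory.GaloisRepresentations.ModPCyclotomicCharacterInertiaSurjective
import Literature.NumberTheory.GaloisRepresentations.LocalGaloisGroupFrobeniusProofs
import HarnessLib

/-!
# K6 crux `MuTransferX9` (stmt-BirchSwinnertonDyer-19276), skeleton v6 stub `stub_stepsTwoFourOdd`:
# a LOCAL arithmetic Frobenius of `ℚ_q` that fixes the `ℓ`-th roots of unity (`res r ∈ Gal(ℚ̄/ℚ(μ_ℓ))`,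
# `ℓ` the prime of `q`) — the element `φ ∈ N` of the Kolyvagin value identity realised locally

Cell `b2b-bsdres` (X9 prover lineage, GEN 45) serving the K6 route `SmallImageMuTransfer` of cell
`bsd-smallim`.  HONEST FRAMING: the cell deletes COMBINATION-SHAPED residual classes of the rank-≤1
BSD formula from PUBLISHED theorems only and TYPES the construction-shaped remainder; this is not
"finishing BSD"; class X9 stays TYPED at class level.  `--supports` helper toward
stmt-BirchSwinnertonDyer-19276 (`stub_stepsTwoFourOdd` of skeleton v6 `a90a661b046bb403` / v6d);
books nothing, closes nothing; THEOREMS ONLY (no definition, no named fact, no `sorry`).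

## Why

In the assembly of `stub_stepsTwoFourOdd` two local statements at the `E`-split prime `q` must be
evaluated at THE SAME element: koly's STEP 4 ⊕ Lemma 1 (iii)
(`LocalSplitPrime.convCoeff_eq_zero_of_transverse_of_unramified`) pairs the Kolyvagin value
`c (res t₀)` with `Ψc (res Fr)` for a LOCAL arithmetic Frobenius `Fr ∈ Γ_{ℚ_q}` (`IsAbsArithFrob`),
while the value identity of MU-TRANSFER-PROOF §3 (3.1) (k6-g3 `KolyvaginTwist.rho_sub_eq_of_norm_witness`:
`(ρ(φ) − 1) a = n • y(φ) − w(φ)`) is stated at an element `φ` of `N = Gal(ℚ̄/ℚ(μ_ℓ))` (the tame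
cocycle `y` lives on `N`).  Since `ℚ_q(μ_ℓ)/ℚ_q` is totally ramified (`ℓ` the prime of `q`), an
arithmetic Frobenius of `ℚ_q` can be chosen INSIDE `N`: multiply any Frobenius by the inertia element
on which `χ̄_ℓ` takes the inverse value (`χ̄_ℓ` maps `I_{ℚ_q}` onto `(ℤ/ℓ)ˣ`, Serre LF IV §4).  This
file supplies that element; its `E`-splitness and exact `κ`-depth are then inherited from the stub's
global Frobenius by x9's `isSplit_and_depth_absGaloisRestrict_of_isArithFrobAt_rat` (every local
arithmetic Frobenius qualifies), and `res r` normalises `ℐ_{𝔓₀}`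
(k6-g3 `absGaloisRestrict_normalises_inertia_adicCompletionPrime`), which is the `hkill` input of
`rho_sub_eq_of_norm_witness` via `inv_mul_conj_mem_of_normalises`.

## What

* §1 (any non-archimedean local field `F`): `IsAbsArithFrob.inertia_mul` / `.mul_inertia` — an
  arithmetic Frobenius times an inertia element is an arithmetic Frobenius;
  `exists_isAbsArithFrob_modPCyclotomicCharacterZMod_eq` — if `χ̄_ℓ` maps `I_F` onto `(ℤ/ℓ)ˣ`, every
  value `u` is `χ̄_ℓ(r)` for some arithmetic Frobenius `r` (in particular `u = 1`).
* §2 (`ℚ`, a finite place `q`, `ℓ` its prime in either spelling):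
  **`exists_isAbsArithFrob_absGaloisRestrict_mem_rootsOfUnityFixer`** —
  `∃ r : Γ_{ℚ_q}, IsAbsArithFrob r ∧ res r ∈ rootsOfUnityFixer ℚ (primesEquiv q)` (no instance
  hypotheses: `NeZero (ℓ : ℚ_q)` is derived from `char ℚ_q = 0`), the `absNorm` twin
  `…_rootsOfUnityFixer_absNorm`, and the versions recording `χ̄_ℓ^{ℚ_q}(r) = 1`.

PARTITION (D-0054): X9 (A4) · X10b∧¬Surj (A5) at `p = 3` — Galois-side seam helper toward
`stub_stepsTwoFourOdd`; closes NONE.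

References: J.-P. Serre, *Local Fields* (1979) Ch. I §8 (Frobenius), Ch. IV §4 Prop. 17–18
[SerreLocalFields1979]; K. Rubin, *Euler Systems* (2000) §4.4–§4.5 (`Fr_ℓ ∈ G_{ℚ(μ_ℓ)}` acting on
the derivative classes) [Rubin2000]; B. Perrin-Riou, Ann. Inst. Fourier 48 (1998) Prop. 3.1.6
[PerrinRiou1998AIF]; J. Neukirch, *Algebraic Number Theory* (1999) Ch. II (9.6) [NeukirchANT1999];
HOME/koly/MU-TRANSFER-PROOF.md §3 (3.1), §5 STEP 4.
-/

-- the summit and its single problem are both named `BirchSwinnertonDyer` (registry layout D-0017)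
set_option linter.dupNamespace false

set_option autoImplicit false

noncomputable section

open Function
open scoped NumberField Pointwise
open Field IsDedekindDomain NumberField
open Literature.NumberTheory.GaloisRepresentations
open Literature.NumberTheory.GaloisRepresentations.IsNonarchimedeanLocalField
open Rat.HeightOneSpectrum

namespace Summit.BirchSwinnertonDyer.BirchSwinnertonDyer.Rank1Residual.TameSeams

/-! ## §1 Arithmetic Frobenii and inertia in a local field -/

section LocalField

variable {F : Type*} [Field F] [ValuativeRel F] [TopologicalSpace F] [IsNonarchimedeanLocalField F]

/-- **`I_F · Frob ⊆ Frob`**: an inertia element times an arithmetic Frobenius is an arithmetic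
Frobenius (`(tσ)x − x^q = (t(σx) − σx) + (σx − x^q)`). [cite: SerreLocalFields1979, Ch. I §8] -/
theorem IsAbsArithFrob.inertia_mul {t σ : absoluteGaloisGroup F} (ht : t ∈ absInertia F)
    (hσ : IsAbsArithFrob σ) : IsAbsArithFrob (t * σ) := by
  intro x
  change (t * σ) • x - x ^ _ ∈ absMaximalIdeal F
  have h1 := hσ x
  change σ • x - x ^ _ ∈ absMaximalIdeal F at h1
  have h2 := (mem_absInertia_iff.1 ht) (σ • x)
  have h3 := add_mem h2 h1
  rw [sub_add_sub_cancel] at h3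
  rwa [mul_smul]

/-- **`Frob · I_F ⊆ Frob`**: an arithmetic Frobenius times an inertia element is an arithmetic
Frobenius (`σt = (σtσ⁻¹)σ` and `I_F` is normal). [cite: SerreLocalFields1979, Ch. I §8] -/
theorem IsAbsArithFrob.mul_inertia {t σ : absoluteGaloisGroup F} (hσ : IsAbsArithFrob σ)
    (ht : t ∈ absInertia F) : IsAbsArithFrob (σ * t) := by
  haveI : (absInertia F).Normal := absInertia_normal_holds F
  have h : σ * t = (σ * t * σ⁻¹) * σ := by group
  rw [h]
  exact IsAbsArithFrob.inertia_mul (Subgroup.Normal.conj_mem inferInstance t ht σ) hσ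

/-- **Arithmetic Frobenii with prescribed mod-`ℓ` cyclotomic character**: if `χ̄_ℓ` maps the inertia
group `I_F` onto `(ℤ/ℓ)ˣ` (e.g. `F = ℚ_ℓ`: Serre LF IV §4 Prop. 17–18), then for every
`u ∈ (ℤ/ℓ)ˣ` there is an arithmetic Frobenius `r ∈ Γ_F` with `χ̄_ℓ(r) = u` — adjust any Frobenius
(`exists_isAbsArithFrob_holds`) by an inertia element.
[cite: SerreLocalFields1979, Ch. IV §4, Prop. 17–18] -/
theorem exists_isAbsArithFrob_modPCyclotomicCharacterZMod_eq (ℓ : ℕ) [Fact ℓ.Prime]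
    [NeZero ((ℓ : ℕ) : F)]
    (hχI : ∀ u : (ZMod ℓ)ˣ, ∃ t ∈ absInertia F, modPCyclotomicCharacterZMod F ℓ t = u)
    (u : (ZMod ℓ)ˣ) :
    ∃ r : absoluteGaloisGroup F, IsAbsArithFrob r ∧ modPCyclotomicCharacterZMod F ℓ r = u := by
  obtain ⟨r₀, hr₀⟩ := exists_isAbsArithFrob_holds F
  obtain ⟨t, ht, hχt⟩ := hχI (u * (modPCyclotomicCharacterZMod F ℓ r₀)⁻¹)
  refine ⟨t * r₀, IsAbsArithFrob.inertia_mul ht hr₀, ?_⟩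
  rw [map_mul, hχt, inv_mul_cancel_right]

end LocalField

/-! ## §2 Over `ℚ`: a local arithmetic Frobenius at `q` fixing `μ_ℓ` -/

section Rat

/-- `ℓ ≠ 0` in `ℚ_q` for a prime (indeed any nonzero) natural number `ℓ`: `ℚ → ℚ_q` is injective.
[cite: NeukirchANT1999, Ch. II (9.6)] -/
theorem neZero_natCast_adicCompletion (q : HeightOneSpectrum (𝓞 ℚ)) (ℓ : ℕ) [NeZero ℓ] :
    NeZero ((ℓ : ℕ) : q.adicCompletion ℚ) :=
  NeZero.nat_of_injective (algebraMap ℚ (q.adicCompletion ℚ)).injective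

/-- **A local arithmetic Frobenius of `ℚ_q` with `χ̄_ℓ = 1`**, `ℓ = primesEquiv q` the residue
characteristic: `ℚ_q(μ_ℓ)/ℚ_q` is totally ramified, so a Frobenius can be chosen acting trivially
on `μ_ℓ`. [cite: SerreLocalFields1979, Ch. IV §4, Prop. 17–18] -/
theorem exists_isAbsArithFrob_modPCyclotomicCharacterZMod_eq_one (q : HeightOneSpectrum (𝓞 ℚ))
    [Fact (((primesEquiv q : Nat.Primes) : ℕ)).Prime]
    [NeZero ((((primesEquiv q : Nat.Primes) : ℕ) : ℕ) : q.adicCompletion ℚ)] :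
    ∃ r : absoluteGaloisGroup (q.adicCompletion ℚ), IsAbsArithFrob r ∧
      modPCyclotomicCharacterZMod (q.adicCompletion ℚ) ((primesEquiv q : Nat.Primes) : ℕ) r = 1 :=
  exists_isAbsArithFrob_modPCyclotomicCharacterZMod_eq _
    (fun u => Rat.exists_mem_absInertia_adicCompletion_modPCyclotomicCharacterZMod_eq q rfl u) 1

/-- The same in the `absNorm` currency of koly's local files (`ℓ = Ideal.absNorm q.asIdeal`).
[cite: SerreLocalFields1979, Ch. IV §4, Prop. 17–18] -/
theorem exists_isAbsArithFrob_modPCyclotomicCharacterZMod_absNorm_eq_one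
    (q : HeightOneSpectrum (𝓞 ℚ)) [Fact (Ideal.absNorm q.asIdeal).Prime]
    [NeZero ((Ideal.absNorm q.asIdeal : ℕ) : q.adicCompletion ℚ)] :
    ∃ r : absoluteGaloisGroup (q.adicCompletion ℚ), IsAbsArithFrob r ∧
      modPCyclotomicCharacterZMod (q.adicCompletion ℚ) (Ideal.absNorm q.asIdeal) r = 1 :=
  exists_isAbsArithFrob_modPCyclotomicCharacterZMod_eq _
    (fun u => Rat.exists_mem_absInertia_adicCompletion_modPCyclotomicCharacterZMod_eq_of_absNorm_eq
      q rfl u) 1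

/-- **The element `φ ∈ N` of the value identity, as a LOCAL arithmetic Frobenius**: there is
`r ∈ Γ_{ℚ_q}` which is an arithmetic Frobenius of `ℚ_q` and whose restriction to `ℚ̄` lies in
`N = Gal(ℚ̄/ℚ(μ_ℓ))`, `ℓ = primesEquiv q` (no instance hypotheses).  With x9's
`isSplit_and_depth_absGaloisRestrict_of_isArithFrobAt_rat`, `res r` is moreover `E`-split of the
same `κ`-depth as the stub's global Frobenius, and it normalises `ℐ_{𝔓₀}`
(`KolyvaginTwist.absGaloisRestrict_normalises_inertia_adicCompletionPrime`).
[cite: Rubin2000, §4.4–§4.5] [cite: PerrinRiou1998AIF, Prop. 3.1.6] -/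
theorem exists_isAbsArithFrob_absGaloisRestrict_mem_rootsOfUnityFixer (q : HeightOneSpectrum (𝓞 ℚ)) :
    ∃ r : absoluteGaloisGroup (q.adicCompletion ℚ), IsAbsArithFrob r ∧
      absGaloisRestrict ℚ (q.adicCompletion ℚ) r ∈
        rootsOfUnityFixer ℚ ((primesEquiv q : Nat.Primes) : ℕ) := by
  haveI : Fact (((primesEquiv q : Nat.Primes) : ℕ)).Prime := ⟨(primesEquiv q).2⟩
  haveI : NeZero ((primesEquiv q : Nat.Primes) : ℕ) := ⟨(primesEquiv q).2.ne_zero⟩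
  haveI := neZero_natCast_adicCompletion q ((primesEquiv q : Nat.Primes) : ℕ)
  obtain ⟨r, hr, hχ⟩ := exists_isAbsArithFrob_modPCyclotomicCharacterZMod_eq_one q
  exact ⟨r, hr, KolyvaginTwist.absGaloisRestrict_mem_rootsOfUnityFixer_of q _ hχ⟩

/-- The same with `N` spelled `rootsOfUnityFixer ℚ (Ideal.absNorm q.asIdeal)`.
[cite: Rubin2000, §4.4–§4.5] -/
theorem exists_isAbsArithFrob_absGaloisRestrict_mem_rootsOfUnityFixer_absNorm
    (q : HeightOneSpectrum (𝓞 ℚ)) :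
    ∃ r : absoluteGaloisGroup (q.adicCompletion ℚ), IsAbsArithFrob r ∧
      absGaloisRestrict ℚ (q.adicCompletion ℚ) r ∈ rootsOfUnityFixer ℚ (Ideal.absNorm q.asIdeal) := by
  rw [Literature.NumberTheory.LFunctions.absNorm_asIdeal_eq_primesEquiv]
  exact exists_isAbsArithFrob_absGaloisRestrict_mem_rootsOfUnityFixer q

/-- **Both at once, for the assembler**: a local arithmetic Frobenius `r` of `ℚ_q` with
`res r ∈ Gal(ℚ̄/ℚ(μ_ℓ))` in BOTH spellings of `ℓ` and `χ̄_{N q}^{ℚ_q}(r) = 1` (instance binders as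
in koly's local section). [cite: Rubin2000, §4.4–§4.5] [cite: SerreLocalFields1979, Ch. IV §4, Prop. 17–18] -/
theorem exists_isAbsArithFrob_mem_rootsOfUnityFixer_and (q : HeightOneSpectrum (𝓞 ℚ))
    [Fact (Ideal.absNorm q.asIdeal).Prime]
    [NeZero ((Ideal.absNorm q.asIdeal : ℕ) : q.adicCompletion ℚ)] :
    ∃ r : absoluteGaloisGroup (q.adicCompletion ℚ), IsAbsArithFrob r ∧
      absGaloisRestrict ℚ (q.adicCompletion ℚ) r ∈
        rootsOfUnityFixer ℚ ((primesEquiv q : Nat.Primes) : ℕ) ∧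
      absGaloisRestrict ℚ (q.adicCompletion ℚ) r ∈ rootsOfUnityFixer ℚ (Ideal.absNorm q.asIdeal) ∧
      modPCyclotomicCharacterZMod (q.adicCompletion ℚ) (Ideal.absNorm q.asIdeal) r = 1 := by
  obtain ⟨r, hr, hχ⟩ := exists_isAbsArithFrob_modPCyclotomicCharacterZMod_absNorm_eq_one q
  have hN := KolyvaginTwist.absGaloisRestrict_mem_rootsOfUnityFixer_of q _ hχ
  refine ⟨r, hr, ?_, hN, hχ⟩
  rw [← Literature.NumberTheory.LFunctions.absNorm_asIdeal_eq_primesEquiv]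
  exact hN

end Rat

end Summit.BirchSwinnertonDyer.BirchSwinnertonDyer.Rank1Residual.TameSeams

end
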